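import Literature.Combinatorics.SimpleGraph.LinearOrderDivisors
import HarnessLib

/-!
# The Riemann–Roch theorem for graphs: `r(D) − r(K − D) = deg(D) + 1 − g`
# (Baker–Norine 2007, Theorem 1.12), with Lemma 2.7, Clifford's theorem (Corollary 3.5),
# `r(K) = g − 1`, and Theorem 1.9 (`deg D ≥ g ⇒ |D| ≠ ∅`)

Source (held, read at the page; statements VERBATIM). M. Baker, S. Norine, *Riemann–Roch and
Abel–Jacobi theory on a finite graph*, Adv. Math. 215 (2007) 766–788 [BakerNorine2007] (held text
`paper:doi-10-1016-j-aim-2007-04-012` pp. 6–11, 15–16). «**Theorem 1.12** (Riemann–Roch for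
Graphs). Let `G` be a graph, and let `D` be a divisor on `G`. Then
`r(D) − r(K − D) = deg(D) + 1 − g`.» §2: «If `D = Σ_i a_i (x_i) ∈ Div(X)`, we define
`deg⁺(D) = Σ_{a_i ≥ 0} a_i`. […] **Lemma 2.7.** If (RR1) holds then for every `D ∈ Div(X)` we
have (2.8) `r(D) = ( min_{D′ ∼ D, ν ∈ 𝒩} deg⁺(D′ − ν) ) − 1`. **Proof.** Let `r′(D)` denote the
right-hand side of (2.8). If `r(D) < r′(D)`, then there exists an effective divisor `E` of degree
`r′(D)` for which `r(D − E) = −1`. By (RR1), this means that there exists a divisor `ν ∈ 𝒩` and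
an effective divisor `E′` such that `ν − D + E ∼ E′`. But then `D′ − ν = E − E′` for some divisor
`D′ ∼ D`, and thus `deg⁺(D′ − ν) − 1 ≤ deg(E) − 1 = r′(D) − 1`, contradicting the definition of
`r′(D)`. […] Conversely, if we choose divisors `D′ ∼ D` and `ν ∈ 𝒩` achieving the minimum in
(2.8), then `deg⁺(D′ − ν) = r′(D) + 1`, and therefore there are effective divisors `E, E′` with
`deg(E) = r′(D) + 1` such that `D′ − ν = E − E′`. But then `D − E ∼ ν − E′`, and since `ν − E′` is
not equivalent to any effective divisor, it follows that `|D − E| = ∅`. Therefore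
`r(D) ≤ r′(D)`. […] (proof of Theorem 2.2) For every `ν ∈ 𝒩`, property (RR2) implies that
`ν̄ := K − ν` is also in `𝒩`. Writing `ν − D′ = K − D′ − ν̄`, it follows that
`deg⁺(D′ − ν) − deg⁺((K − D′) − ν̄) = deg⁺(D′ − ν) − deg⁺(ν − D′) = deg(D′ − ν) = deg(D) + 1 − g`.
Since the difference […] has the constant value `deg(D) + 1 − g` for all `D′` and `ν`, and since
`ν̄ = K − ν` runs through all possible elements of `𝒩` as `ν` does, it follows from Lemmas 2.6 and
2.7 that `r(D) − r(K − D) = deg(D) + 1 − g`.» «**Remark 2.4** […] (ii) When the Riemann–Roch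
formula (2.3) holds, we automatically have `r(K) = g − 1`.» §3.3: «we call a divisor `D` special
if `|K − D| ≠ ∅`, and non-special otherwise. **Corollary 3.5** (Clifford's Theorem for Graphs).
Let `D` be an effective special divisor on a graph `G`. Then `r(D) ≤ ½ deg(D)`. **Proof.** If `D`
is effective and special, then `K − D` is also effective, and by Lemma 2.1 we have
`r(D) + r(K − D) ≤ r(K) = g − 1`. On the other hand, by Riemann–Roch we have
`r(D) − r(K − D) = deg(D) + 1 − g`. Adding these two expressions gives `2r(D) ≤ deg(D)` as
desired.» §1.5: «**Theorem 1.9.** Let `N = deg(D)` be the total number of dollars present at any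
stage of the game. 1. If `N ≥ g`, then there is always a winning strategy. 2. If `N ≤ g − 1`, then
there is always an initial configuration for which no winning strategy exists.»

## What is formalised (vocabulary of `GraphDivisors`, `LinearOrderDivisors`; `G` connected;
## `deg⁺(F)` is written `∑ v, max (F v) 0`, and `𝒩` is represented by the `ν_P` (Corollary 3.4))

* Lemma 2.7 for the family `ν_P`: **`rank_le_sum_max_sub_one`** («if we choose divisors `D′ ∼ D`
  and `ν` […] then […] `|D − E| = ∅`»: `r(D) ≤ deg⁺(D′ − ν_P) − 1` for every `D′ ∼ D` and every
  order), **`exists_sum_max_le_rank_add_one`** (the minimum is attained: some `D′ ∼ D` and linear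
  order have `deg⁺(D′ − ν_P) ≤ r(D) + 1`, via Theorem 3.3 = (RR1));
* the (RR2) bookkeeping `sum_max_sub_sum_max_neg` (`deg⁺(F) − deg⁺(−F) = deg F`) and the one-sided
  estimate `rank_canonical_sub_sub_rank_le` (`r(K − D) − r(D) ≤ g − 1 − deg D`, through
  `ν_{P̄} = K − ν_P`);
* **Theorem 1.12** **`rank_sub_rank_canonical_sub`** (`r(D) − r(K − D) = deg(D) + 1 − g`);
* consequences: **`rank_canonicalDivisor`** («`r(K) = g − 1`», Remark 2.4 (ii)),
  `sum_sub_genus_le_rank` (Riemann's inequality `r(D) ≥ deg D − g`), **Theorem 1.9 (1)**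
  `winnable_of_genus_le_sum` and the two parts together `forall_winnable_iff_genus_le`,
  `rank_eq_of_lt_sum` (`deg D > 2g − 2 ⇒ r(D) = deg D − g`), (RR2) `winnable_iff_winnable_sub`
  (for `deg D = g − 1`: `|D| ≠ ∅ ⟺ |K − D| ≠ ∅`), and **Corollary 3.5 (Clifford)**
  `two_mul_rank_le_sum` (`2r(D) ≤ deg D` for `D` special with `|D| ≠ ∅`, in particular for `D`
  effective special: `two_mul_rank_le_sum_of_nonneg`).

Theorems only; no `sorry`; no named facts.
-/

open Finset SimpleGraph Matrix
open Literature.Combinatorics.SimpleGraph.ChipFiring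

namespace Literature.Combinatorics.SimpleGraph.BakerNorine

variable {V : Type*} [Fintype V] [DecidableEq V] {G : SimpleGraph V} [DecidableRel G.Adj]

/-! ### §1 Lemma 2.7: `r(D) + 1 = min deg⁺(D′ − ν_P)` -/

section AltDimension

/-- **Lemma 2.7, `r(D) ≤ r′(D)`**: for every `D′ ∼ D` and every order, `r(D) ≤ deg⁺(D′ − ν_P) − 1`
(«there are effective divisors `E, E′` […] such that `D′ − ν = E − E′`. But then
`D − E ∼ ν − E′`, and since `ν − E′` is not equivalent to any effective divisor, it follows that
`|D − E| = ∅`»). [cite: BakerNorine2007, Lemma 2.7] -/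
theorem rank_le_sum_max_sub_one [Nonempty V] {D D' : V → ℤ} (h : LinEquiv G D D') (ρ : V → ℕ) :
    rank G D ≤ (∑ v, max ((D' - orderDivisor G ρ) v) 0) - 1 := by
  have hE : (0 : V → ℤ) ≤ fun v => max ((D' - orderDivisor G ρ) v) 0 := fun v => le_max_right _ _
  obtain ⟨s, hs⟩ := Int.eq_ofNat_of_zero_le
    (Finset.sum_nonneg fun v (_ : v ∈ univ) => hE v : (0 : ℤ) ≤ ∑ v, max ((D' - orderDivisor G ρ) v) 0)
  have hlt : rank G D < s := by
    rw [rank_lt_iff]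
    refine ⟨fun v => max ((D' - orderDivisor G ρ) v) 0, hE, hs, fun hW => not_winnable_orderDivisor G ρ ?_⟩
    -- `D − E ∼ D′ − E = ν − E′` with `E′ = E − (D′ − ν) ≥ 0`
    have hE' : (0 : V → ℤ) ≤ (fun v => max ((D' - orderDivisor G ρ) v) 0) - (D' - orderDivisor G ρ) :=
      fun v => by
        rw [Pi.zero_apply, Pi.sub_apply]
        exact sub_nonneg.2 (le_max_left _ _)
    have key := ((h.sub_right _).winnable hW).add_nonneg hE'
    have heq : D' - (fun v => max ((D' - orderDivisor G ρ) v) 0)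
        + ((fun v => max ((D' - orderDivisor G ρ) v) 0) - (D' - orderDivisor G ρ)) = orderDivisor G ρ := by
      abel
    rwa [heq] at key
  linarith

/-- **Lemma 2.7, `r(D) ≥ r′(D)`**: some `D′ ∼ D` and some linear order have
`deg⁺(D′ − ν_P) ≤ r(D) + 1` («there exists an effective divisor `E` of degree `r′(D)` for which
`r(D − E) = −1`. By (RR1), this means that there exists a divisor `ν ∈ 𝒩` and an effective
divisor `E′` such that `ν − D + E ∼ E′`. But then `D′ − ν = E − E′` for some divisor `D′ ∼ D`, and
thus `deg⁺(D′ − ν) − 1 ≤ deg(E) − 1`»; (RR1) is Theorem 3.3). [cite: BakerNorine2007, Lemma 2.7] -/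
theorem exists_sum_max_le_rank_add_one (hG : G.Connected) (D : V → ℤ) :
    ∃ D' : V → ℤ, ∃ ρ : V → ℕ, Function.Injective ρ ∧ LinEquiv G D D' ∧
      (∑ v, max ((D' - orderDivisor G ρ) v) 0) ≤ rank G D + 1 := by
  haveI : Nonempty V := hG.nonempty
  have hr := neg_one_le_rank G D
  obtain ⟨s, hs⟩ := Int.eq_ofNat_of_zero_le (show 0 ≤ rank G D + 1 by omega)
  obtain ⟨E, hE, hEs, hW⟩ := (rank_lt_iff G D s).1 (by omega)
  rcases winnable_or_exists_winnable_orderDivisor_sub hG (D - E) with hDE | ⟨ρ, hρ, E', hE', hνE'⟩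
  · exact absurd hDE hW
  · refine ⟨orderDivisor G ρ + E - E', ρ, hρ, ?_, ?_⟩
    · rw [linEquiv_iff] at hνE' ⊢
      have := neg_mem hνE'
      have heq : D - (orderDivisor G ρ + E - E') = -(orderDivisor G ρ - (D - E) - E') := by abel
      rwa [heq]
    · rw [hs, ← hEs]
      refine Finset.sum_le_sum fun v _ => ?_
      have h1 : (0 : ℤ) ≤ E v := hE v
      have h2 : (0 : ℤ) ≤ E' v := hE' v
      simp only [Pi.sub_apply, Pi.add_apply]
      omega

/-- **Lemma 2.7 (2.8)** for graphs: «`r(D) = ( min_{D′ ∼ D, ν ∈ 𝒩} deg⁺(D′ − ν) ) − 1`», the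
non-special divisors `𝒩` being the `ν_P` up to `∼` (Corollary 3.4): `r(D) + 1` is the least
value of `deg⁺(D′ − ν_P)` over `D′ ∼ D` and linear orders `P`. [cite: BakerNorine2007, Lemma 2.7] -/
theorem isLeast_sum_max_rank_add_one (hG : G.Connected) (D : V → ℤ) :
    IsLeast {n : ℤ | ∃ D' : V → ℤ, ∃ ρ : V → ℕ, Function.Injective ρ ∧ LinEquiv G D D' ∧
      (∑ v, max ((D' - orderDivisor G ρ) v) 0) = n} (rank G D + 1) := by
  haveI : Nonempty V := hG.nonempty
  constructor
  · obtain ⟨D', ρ, hρ, h, hle⟩ := exists_sum_max_le_rank_add_one hG D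
    have hge := rank_le_sum_max_sub_one h ρ
    exact ⟨D', ρ, hρ, h, by omega⟩
  · rintro n ⟨D', ρ, -, h, rfl⟩
    have := rank_le_sum_max_sub_one h ρ
    omega

end AltDimension

/-! ### §2 Theorem 1.12 -/

section RiemannRoch

omit [DecidableEq V] [DecidableRel G.Adj] in
/-- «`deg⁺(D′ − ν) − deg⁺(ν − D′) = deg(D′ − ν)`»: `deg⁺(F) − deg⁺(−F) = deg F`.
[cite: BakerNorine2007, Theorem 2.2 (proof)] -/
theorem sum_max_sub_sum_max_neg (F : V → ℤ) :
    (∑ v, max (F v) 0) - ∑ v, max ((-F) v) 0 = ∑ v, F v := by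
  rw [← Finset.sum_sub_distrib]
  exact Finset.sum_congr rfl fun v _ => by
    rw [Pi.neg_apply]
    omega

/-- One half of Riemann–Roch: `r(K − D) − r(D) ≤ g − 1 − deg(D)` («Writing
`ν − D′ = K − D′ − ν̄` […] `deg⁺(D′ − ν) − deg⁺((K − D′) − ν̄) = […] = deg(D) + 1 − g`», with
`ν̄ = ν_{P̄} = K − ν_P`). [cite: BakerNorine2007, Theorem 2.2 (proof) and Theorem 1.12 (proof)] -/
theorem rank_canonical_sub_sub_rank_le (hG : G.Connected) (D : V → ℤ) :
    rank G (canonicalDivisor G - D) - rank G D ≤ genus G - 1 - ∑ v, D v := by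
  haveI : Nonempty V := hG.nonempty
  obtain ⟨D', ρ, hρ, hDD', hle⟩ := exists_sum_max_le_rank_add_one hG D
  -- Lemma 2.7's bound for `K − D` at `K − D′ ∼ K − D` and the reverse order
  have hA := rank_le_sum_max_sub_one (hDD'.sub_left (canonicalDivisor G)) (revRank ρ)
  rw [orderDivisor_revRank G hρ] at hA
  have heq : canonicalDivisor G - D' - (canonicalDivisor G - orderDivisor G ρ)
      = -(D' - orderDivisor G ρ) := by abel
  rw [heq] at hA
  have hd := sum_max_sub_sum_max_neg (D' - orderDivisor G ρ)
  have hsum : ∑ v, (D' - orderDivisor G ρ) v = ∑ v, D v - (genus G - 1) := by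
    simp only [Pi.sub_apply, Finset.sum_sub_distrib, sum_orderDivisor G hρ, hDD'.sum_eq]
  rw [hsum] at hd
  linarith

/-- **Theorem 1.12 (Riemann–Roch for Graphs).** «Let `G` be a graph, and let `D` be a divisor on
`G`. Then `r(D) − r(K − D) = deg(D) + 1 − g`» (`G` connected, as throughout B–N).
[cite: BakerNorine2007, Theorem 1.12] -/
theorem rank_sub_rank_canonical_sub (hG : G.Connected) (D : V → ℤ) :
    rank G D - rank G (canonicalDivisor G - D) = ∑ v, D v + 1 - genus G := by
  have h1 := rank_canonical_sub_sub_rank_le hG D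
  have h2 := rank_canonical_sub_sub_rank_le hG (canonicalDivisor G - D)
  rw [sub_sub_cancel] at h2
  simp only [Pi.sub_apply, Finset.sum_sub_distrib, sum_canonicalDivisor] at h2
  omega

end RiemannRoch

/-! ### §3 Consequences -/

section Consequences

/-- **Remark 2.4 (ii).** «When the Riemann–Roch formula (2.3) holds, we automatically have
`r(K) = g − 1`.» [cite: BakerNorine2007, Remark 2.4 (ii)] -/
theorem rank_canonicalDivisor (hG : G.Connected) : rank G (canonicalDivisor G) = genus G - 1 := by
  haveI : Nonempty V := hG.nonempty
  have h := rank_sub_rank_canonical_sub hG (canonicalDivisor G)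
  rw [sub_self, rank_zero, sum_canonicalDivisor] at h
  omega

/-- Riemann's inequality `r(D) ≥ deg(D) − g` (from Theorem 1.12 and `r(K − D) ≥ −1`).
[cite: BakerNorine2007, Theorem 1.12 and Theorem 1.9 (1)] -/
theorem sum_sub_genus_le_rank (hG : G.Connected) (D : V → ℤ) : ∑ v, D v - genus G ≤ rank G D := by
  have h := rank_sub_rank_canonical_sub hG D
  have h' := neg_one_le_rank G (canonicalDivisor G - D)
  omega

/-- **Theorem 1.9 (1).** «If `N ≥ g`, then there is always a winning strategy.»
[cite: BakerNorine2007, Theorem 1.9 (1)] -/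
theorem winnable_of_genus_le_sum (hG : G.Connected) {D : V → ℤ} (h : genus G ≤ ∑ v, D v) :
    Winnable G D := by
  haveI : Nonempty V := hG.nonempty
  have := sum_sub_genus_le_rank hG D
  exact (rank_nonneg_iff G D).1 (by omega)

/-- **Theorem 1.9** (both parts): every configuration with `N` dollars has a winning strategy
iff `N ≥ g`. [cite: BakerNorine2007, Theorem 1.9] -/
theorem forall_winnable_iff_genus_le (hG : G.Connected) (N : ℤ) :
    (∀ D : V → ℤ, ∑ v, D v = N → Winnable G D) ↔ genus G ≤ N := by
  constructor
  · intro h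
    by_contra hlt
    obtain ⟨D, hD, hW⟩ := exists_not_winnable_of_le hG (N := N) (by omega)
    exact hW (h D hD)
  · intro h D hD
    exact winnable_of_genus_le_sum hG (by omega)

/-- Non-special divisors of large degree: `deg(D) > 2g − 2 ⇒ r(D) = deg(D) − g` (then
`deg(K − D) < 0`, so `r(K − D) = −1`). [cite: BakerNorine2007, Theorem 1.12 (with §2: «`r(D) = −1`
if `deg(D) < 0`»)] -/
theorem rank_eq_of_lt_sum (hG : G.Connected) {D : V → ℤ} (h : 2 * genus G - 2 < ∑ v, D v) :
    rank G D = ∑ v, D v - genus G := by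
  haveI : Nonempty V := hG.nonempty
  have hRR := rank_sub_rank_canonical_sub hG D
  have hK : rank G (canonicalDivisor G - D) = -1 := rank_eq_neg_one_of_sum_neg G (by
    simp only [Pi.sub_apply, Finset.sum_sub_distrib, sum_canonicalDivisor]
    omega)
  omega

/-- **(RR2)** «For every `D ∈ Div(X)` with `deg(D) = g − 1`, we have `ε(D) + ε(K − D) = 0`»:
`|D| ≠ ∅ ⟺ |K − D| ≠ ∅`. [cite: BakerNorine2007, Theorem 2.2 (RR2)] -/
theorem winnable_iff_winnable_canonical_sub (hG : G.Connected) {D : V → ℤ}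
    (hdeg : ∑ v, D v = genus G - 1) : Winnable G D ↔ Winnable G (canonicalDivisor G - D) := by
  haveI : Nonempty V := hG.nonempty
  have hRR := rank_sub_rank_canonical_sub hG D
  rw [← rank_nonneg_iff, ← rank_nonneg_iff]
  omega

/-- **(RR1)** «For every `D ∈ Div(X)`, there exists `ν ∈ 𝒩` such that `ε(D) + ε(ν − D) = 1`»:
with `ν = ν_P` for a suitable linear order. [cite: BakerNorine2007, Theorem 2.2 (RR1) and
Theorem 3.3] -/
theorem exists_winnable_xor (hG : G.Connected) (D : V → ℤ) :
    ∃ ρ : V → ℕ, Function.Injective ρ ∧ Xor (Winnable G D) (Winnable G (orderDivisor G ρ - D)) := by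
  haveI : Nonempty V := hG.nonempty
  rcases winnable_or_exists_winnable_orderDivisor_sub hG D with h | ⟨ρ, hρ, h⟩
  · refine ⟨fun v => ((Fintype.equivFin V) v : ℕ),
      fun v w h => (Fintype.equivFin V).injective (Fin.ext h), Or.inl ⟨h, ?_⟩⟩
    exact h.not_winnable_orderDivisor_sub _
  · exact ⟨ρ, hρ, Or.inr ⟨h, fun hD => hD.not_winnable_orderDivisor_sub ρ h⟩⟩

/-- **Corollary 3.5 (Clifford's Theorem for Graphs)** for special divisors with `|D| ≠ ∅`:
«`r(D) + r(K − D) ≤ r(K) = g − 1`. On the other hand, by Riemann–Roch we have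
`r(D) − r(K − D) = deg(D) + 1 − g`. Adding these two expressions gives `2r(D) ≤ deg(D)`.»
[cite: BakerNorine2007, Corollary 3.5] -/
theorem two_mul_rank_le_sum (hG : G.Connected) {D : V → ℤ} (hD : Winnable G D)
    (hKD : Winnable G (canonicalDivisor G - D)) : 2 * rank G D ≤ ∑ v, D v := by
  haveI : Nonempty V := hG.nonempty
  have h1 := rank_add_le_rank_add G ((rank_nonneg_iff G D).2 hD) ((rank_nonneg_iff G _).2 hKD)
  rw [add_sub_cancel, rank_canonicalDivisor hG] at h1
  have h2 := rank_sub_rank_canonical_sub hG D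
  omega

/-- **Corollary 3.5 (Clifford's Theorem for Graphs).** «Let `D` be an effective special divisor on
a graph `G`. Then `r(D) ≤ ½ deg(D)`» (special: «`|K − D| ≠ ∅`»).
[cite: BakerNorine2007, Corollary 3.5] -/
theorem two_mul_rank_le_sum_of_nonneg (hG : G.Connected) {D : V → ℤ} (hD : 0 ≤ D)
    (hKD : Winnable G (canonicalDivisor G - D)) : 2 * rank G D ≤ ∑ v, D v :=
  two_mul_rank_le_sum hG (winnable_of_nonneg G hD) hKD

end Consequences

end Literature.Combinatorics.SimpleGraph.BakerNorine
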